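import Summits.CriticalPhenomena.PercolationContinuityZ3.Theorems.PercNearOneGluingNoHeavyLowerTailStarSetResidualFacts
import HarnessLib

/-!
# `NoHeavyLowerTail` (stmt-CriticalPhenomena-4575) — the residual ledger, Ia: the r-class word families are disjoint (U1-PROOF.md §9)

Support file (prover `prim-gen-swap` gen 15; `--supports stmt-CriticalPhenomena-4575`).  No definitions, no named facts, no sorries.

Five word families of the residual bound are filed under class-sets containing a class through `r`, each with coefficient `1`:
the R1-rider words `{X, I₀, ρ}`, the SELF words `{X, J, dom X ē}` and the flagged SELF′ words `{X, J, I₀}` of the group units, the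
SELF_I words `{X, I₀, dom X a}` and the CROSS_I words `{X, Y, I₀}` of the `I₀`-units.  This file shows that the five families of
class-sets are pairwise disjoint (ten pairs), from the unit data (`StarSet.residual_unit_facts`) — here the four pairs
involving the R1-rider family; part Ib has the other six.

* `StarSet.residual_rwords_disjoint_R1`.
-/

namespace Summit.CriticalPhenomena.PercolationContinuityZ3.Theorems

open Finset
open scoped BigOperators Classical

namespace StarSet

variable {ι V : Type*} [LinearOrder ι] [DecidableEq V]

/-- **The R1-rider class-sets are disjoint from the SELF / SELF′ / SELF_I / CROSS_I class-sets.**  See the file header. -/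
theorem residual_rwords_disjoint_R1 (P P' : ι → V) (hPP' : ∀ X, P X ≠ P' X)
    (hinj : Function.Injective fun X => (s(P X, P' X) : Sym2 V)) (r : V) (F : Finset ι)
    (dom : ι → V → ι)
    (hdom : ∀ X ∉ F, ∀ d, (P X = d ∨ P' X = d) →
      dom X d ∈ F ∧ (P (dom X d) = d ∨ P' (dom X d) = d) ∧
        (∀ u, (P (dom X d) = u ∨ P' (dom X d) = u) → (P X = u ∨ P' X = u) → u = d))
    (I₀ : ι) (hleaf : ∀ I ∈ F, P' I = r → I = I₀) (hI₀r : I₀ ∈ F → P' I₀ = r)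
    (U : Finset (Finset ι × ι)) (Jf : Finset ι × ι → ι) (ef ēf : Finset ι × ι → V) (ρf : Finset ι × ι → ι)
    (hdata : (∀ u ∈ U, u.2 ∈ u.1 ∧ u.2 ∉ F ∧ (P u.2 ≠ r ∧ P' u.2 ≠ r) ∧
      (∀ Y ∈ u.1, P Y = P u.2 ∨ P Y = P' u.2 ∨ P' Y = P u.2 ∨ P' Y = P' u.2) ∧
      ¬ ((∀ I ∈ F, I ∉ u.1) ∨ ∃ a ∈ F, P a = r ∧ a ∈ u.1 ∧ ∀ b ∈ F, b < a → b ∉ u.1) ∧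
      Jf u ∈ u.1 ∧ Jf u ∈ F ∧ (∀ I ∈ u.1, I ∈ F → Jf u ≤ I) ∧ P (Jf u) ≠ r ∧
      ((P u.2 = ef u ∧ P' u.2 = ēf u) ∨ (P u.2 = ēf u ∧ P' u.2 = ef u)) ∧ (P (Jf u) = ef u ∨ P' (Jf u) = ef u) ∧
      ¬ (P (Jf u) = ēf u ∨ P' (Jf u) = ēf u) ∧
      ((P (Jf u) = ef u ∧ P' (Jf u) = r ∧ P (dom u.2 (ēf u)) ≠ r ∧ P' (dom u.2 (ēf u)) ≠ r) ∨
       (P (Jf u) ≠ r ∧ P' (Jf u) ≠ r ∧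
        ((P (dom u.2 (ēf u)) = r ∧ P' (dom u.2 (ēf u)) = ēf u ∧ Jf u < dom u.2 (ēf u)) ∨
         (P (dom u.2 (ēf u)) = ēf u ∧ P' (dom u.2 (ēf u)) = r)))) ∧
      (∀ Y ∈ u.1, Y ≠ u.2 → (P Y ≠ r ∧ P' Y ≠ r) → ∀ p, (P u.2 = p ∨ P' u.2 = p) → (P Y ≠ p ∧ P' Y ≠ p) →
        (P (dom u.2 p) = r ∨ P' (dom u.2 p) = r))))
    (hρ : (∀ u ∈ U, (((u.1.erase u.2).erase (Jf u)).filter (fun K => (P K ≠ r ∧ P' K ≠ r) ∧ K ≠ dom u.2 (ēf u))).Nonempty → ρf u ∈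
        (((u.1.erase u.2).erase (Jf u)).filter (fun K => (P K ≠ r ∧ P' K ≠ r) ∧ K ≠ dom u.2 (ēf u)))))
    (UR1 UG UC UH : Finset (Finset ι × ι))
    (hUR1 : UR1 = U.filter (fun u => (P (Jf u) = ef u ∧ P' (Jf u) = r) ∧ (((u.1.erase u.2).erase (Jf u)).filter (fun K => (P K ≠ r ∧ P' K ≠ r) ∧ K ≠
        dom u.2 (ēf u))).Nonempty))
    (hUG : UG = U.filter (fun u => ¬ (P (Jf u) = ef u ∧ P' (Jf u) = r) ∧ ¬ (¬ (P (Jf u) = ef u ∧ P' (Jf u) = r) ∧ dom u.2 (ef u) ≠ Jf u ∧ (P (dom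
        u.2 (ef u)) ≠ r ∧ P' (dom u.2 (ef u)) ≠ r)) ∧ ¬ (((u.1.erase u.2).erase (Jf u)).filter (fun K => (P K ≠ r ∧ P' K ≠ r) ∧ K
        ≠ dom u.2 (ēf u))).Nonempty ∧ ¬ (P' (dom u.2 (ēf u)) = r ∧ Jf u = dom u.2 (ef u))))
    (hUC : UC = U.filter (fun u => (P (Jf u) = ef u ∧ P' (Jf u) = r) ∧ ¬ (((u.1.erase u.2).erase (Jf u)).filter (fun K => (P K ≠ r ∧ P' K ≠ r) ∧ K
        ≠ dom u.2 (ēf u))).Nonempty ∧ dom u.2 (ef u) ≠ Jf u))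
    (hUH : UH = U.filter (fun u => ¬ (((u.1.erase u.2).erase (Jf u)).filter (fun K => (P K ≠ r ∧ P' K ≠ r) ∧ K ≠ dom u.2 (ēf u))).Nonempty ∧ (((P
        (Jf u) = ef u ∧ P' (Jf u) = r) ∧ dom u.2 (ef u) = Jf u) ∨ (¬ (P (Jf u) = ef u ∧ P' (Jf u) = r) ∧ ¬ (¬ (P (Jf u) = ef u ∧
        P' (Jf u) = r) ∧ dom u.2 (ef u) ≠ Jf u ∧ (P (dom u.2 (ef u)) ≠ r ∧ P' (dom u.2 (ef u)) ≠ r)) ∧ (P' (dom u.2 (ēf u)) = r ∧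
        Jf u = dom u.2 (ef u)))))) :
    Disjoint (UR1.image (fun u => ({u.2, I₀, ρf u} : Finset ι))) (UG.image (fun u => ({u.2, Jf u, dom u.2 (ēf u)} : Finset ι))) ∧
    Disjoint (UR1.image (fun u => ({u.2, I₀, ρf u} : Finset ι)))
      ((UG.filter (fun u => (((P u.2 = P I₀ ∨ P' u.2 = P I₀) ∧ I₀ ∈ F ∧ P' I₀ = r) ∧ dom u.2 (ēf u) ≠ I₀))).image (fun u => ({u.2, Jf u, I₀} : Finset ι))) ∧
    Disjoint (UR1.image (fun u => ({u.2, I₀, ρf u} : Finset ι)))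
      ((UC ∪ UH).image (fun u => ({u.2, I₀, dom u.2 (if P u.2 = P I₀ then P' u.2 else P u.2)} : Finset ι))) ∧
    Disjoint (UR1.image (fun u => ({u.2, I₀, ρf u} : Finset ι)))
      ((((UC ∪ UH).image Prod.snd ×ˢ (UC ∪ UH).image Prod.snd).filter (fun p => p.1 < p.2)).image (fun p => ({p.1, p.2, I₀} : Finset ι))) := by
  have facts := residual_unit_facts P P' hPP' hinj r F dom hdom I₀ hleaf hI₀r U Jf ef ēf ρf hdata hρ
  -- ports of a hub
  have hports : ∀ u ∈ U, ∀ x, (P u.2 = x ∨ P' u.2 = x) → x = ef u ∨ x = ēf u := by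
    intro u hu x hx
    obtain ⟨-, -, -, -, -, -, -, -, -, hX, -⟩ := hdata u hu
    rcases hX with ⟨h1, h2⟩ | ⟨h1, h2⟩ <;> rcases hx with h | h
    · exact Or.inl (h.symm.trans h1)
    · exact Or.inr (h.symm.trans h2)
    · exact Or.inr (h.symm.trans h1)
    · exact Or.inl (h.symm.trans h2)
  -- the elements of the five families
  have hA1 : ∀ T ∈ UR1.image (fun u => ({u.2, I₀, ρf u} : Finset ι)), ∃ u ∈ U,
      (P (Jf u) = ef u ∧ P' (Jf u) = r) ∧
      (((u.1.erase u.2).erase (Jf u)).filter (fun K => (P K ≠ r ∧ P' K ≠ r) ∧ K ≠ dom u.2 (ēf u))).Nonempty ∧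
      T = {u.2, I₀, ρf u} := by
    intro T hT
    obtain ⟨u, hu, rfl⟩ := mem_image.1 hT
    rw [hUR1, mem_filter] at hu
    exact ⟨u, hu.1, hu.2.1, hu.2.2, rfl⟩
  have hA2 : ∀ T ∈ UG.image (fun u => ({u.2, Jf u, dom u.2 (ēf u)} : Finset ι)), ∃ v ∈ U,
      ¬ (P (Jf v) = ef v ∧ P' (Jf v) = r) ∧
      ¬ (¬ (P (Jf v) = ef v ∧ P' (Jf v) = r) ∧ dom v.2 (ef v) ≠ Jf v ∧ (P (dom v.2 (ef v)) ≠ r ∧ P' (dom v.2 (ef v)) ≠ r)) ∧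
      ¬ (P' (dom v.2 (ēf v)) = r ∧ Jf v = dom v.2 (ef v)) ∧ T = {v.2, Jf v, dom v.2 (ēf v)} := by
    intro T hT
    obtain ⟨v, hv, rfl⟩ := mem_image.1 hT
    rw [hUG, mem_filter] at hv
    exact ⟨v, hv.1, hv.2.1, hv.2.2.1, hv.2.2.2.2, rfl⟩
  have hA3 : ∀ T ∈ (UG.filter (fun u => (((P u.2 = P I₀ ∨ P' u.2 = P I₀) ∧ I₀ ∈ F ∧ P' I₀ = r) ∧ dom u.2 (ēf u) ≠ I₀))).image
      (fun u => ({u.2, Jf u, I₀} : Finset ι)), ∃ v ∈ U,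
      ¬ (P (Jf v) = ef v ∧ P' (Jf v) = r) ∧
      (((P v.2 = P I₀ ∨ P' v.2 = P I₀) ∧ I₀ ∈ F ∧ P' I₀ = r) ∧ dom v.2 (ēf v) ≠ I₀) ∧ T = {v.2, Jf v, I₀} := by
    intro T hT
    obtain ⟨v, hv, rfl⟩ := mem_image.1 hT
    rw [mem_filter, hUG, mem_filter] at hv
    exact ⟨v, hv.1.1, hv.1.2.1, hv.2, rfl⟩
  have hI : ∀ w ∈ UC ∪ UH, w ∈ U ∧ w.2 ∉ F ∧ (P w.2 = P I₀ ∨ P' w.2 = P I₀) ∧ I₀ ∈ F ∧ P' I₀ = r ∧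
      dom w.2 (if P w.2 = P I₀ then P' w.2 else P w.2) ∈ F ∧
      (P (dom w.2 (if P w.2 = P I₀ then P' w.2 else P w.2)) = (if P w.2 = P I₀ then P' w.2 else P w.2) ∨
        P' (dom w.2 (if P w.2 = P I₀ then P' w.2 else P w.2)) = (if P w.2 = P I₀ then P' w.2 else P w.2)) ∧
      (P (dom w.2 (if P w.2 = P I₀ then P' w.2 else P w.2)) ≠ r ∧ P' (dom w.2 (if P w.2 = P I₀ then P' w.2 else P w.2)) ≠ r) ∧
      (P w.2 = (if P w.2 = P I₀ then P' w.2 else P w.2) ∨ P' w.2 = (if P w.2 = P I₀ then P' w.2 else P w.2)) ∧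
      (if P w.2 = P I₀ then P' w.2 else P w.2) ≠ P I₀ := by
    intro w hw
    have hlast : ∀ X, (P X = P I₀ ∨ P' X = P I₀) → (P X = (if P X = P I₀ then P' X else P X) ∨
        P' X = (if P X = P I₀ then P' X else P X)) ∧ (if P X = P I₀ then P' X else P X) ≠ P I₀ := by
      intro X hXq
      by_cases h : P X = P I₀
      · rw [if_pos h]; exact ⟨Or.inr rfl, fun h' => hPP' X (h.trans h'.symm)⟩
      · rw [if_neg h]; exact ⟨Or.inl rfl, h⟩
    rcases mem_union.1 hw with hw | hw
    · rw [hUC, mem_filter] at hw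
      obtain ⟨hwU, h1, -, -⟩ := hw
      have hXF := (hdata w hwU).2.1
      obtain ⟨-, -, -, -, -, -, ⟨hDF, hDē⟩, -, -, hon, -, -, -⟩ := facts w hwU
      obtain ⟨-, -, hIF, hIr, -, hXq, ha, hcold, -⟩ := hon h1
      refine ⟨hwU, hXF, hXq, hIF, hIr, ?_⟩
      rw [ha]
      exact ⟨hDF, hDē, hcold, ha ▸ hlast _ hXq⟩
    · rw [hUH, mem_filter] at hw
      obtain ⟨hwU, -, hcase⟩ := hw
      have hXF := (hdata w hwU).2.1
      obtain ⟨-, -, -, -, -, -, ⟨hDF, hDē⟩, ⟨hDeF, hDee⟩, hoff, hon, -, hbundle, -⟩ := facts w hwU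
      rcases hcase with ⟨h1, -⟩ | ⟨hn1, -, hb1, hb2⟩
      · obtain ⟨-, -, hIF, hIr, -, hXq, ha, hcold, -⟩ := hon h1
        refine ⟨hwU, hXF, hXq, hIF, hIr, ?_⟩
        rw [ha]
        exact ⟨hDF, hDē, hcold, ha ▸ hlast _ hXq⟩
      · obtain ⟨-, hIF, hIr, -, hXq, ha⟩ := hbundle ⟨hn1, hb1, hb2⟩
        obtain ⟨hJr, -, -⟩ := hoff hn1
        refine ⟨hwU, hXF, hXq, hIF, hIr, ?_⟩
        rw [ha]
        refine ⟨hDeF, hDee, ?_, ha ▸ hlast _ hXq⟩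
        rw [← hb2]; exact hJr
  have hA5 : ∀ T ∈ (((UC ∪ UH).image Prod.snd ×ˢ (UC ∪ UH).image Prod.snd).filter (fun p => p.1 < p.2)).image
      (fun p => ({p.1, p.2, I₀} : Finset ι)),
      ∃ X₁ X₂ : ι, (∃ w ∈ UC ∪ UH, w.2 = X₁) ∧ (∃ w ∈ UC ∪ UH, w.2 = X₂) ∧ X₁ ≠ X₂ ∧ T = {X₁, X₂, I₀} := by
    intro T hT
    obtain ⟨p, hp, rfl⟩ := mem_image.1 hT
    obtain ⟨hp, hlt⟩ := mem_filter.1 hp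
    obtain ⟨h1, h2⟩ := mem_product.1 hp
    obtain ⟨w₁, hw₁, hw₁X⟩ := mem_image.1 h1
    obtain ⟨w₂, hw₂, hw₂X⟩ := mem_image.1 h2
    exact ⟨p.1, p.2, ⟨w₁, hw₁, hw₁X⟩, ⟨w₂, hw₂, hw₂X⟩, ne_of_lt hlt, rfl⟩
  refine ⟨?_, ?_, ?_, ?_⟩ <;> refine disjoint_left.2 fun T hT1 hT2 => ?_
  · -- R1 vs SELF
    obtain ⟨u, hu, h1, hne, rfl⟩ := hA1 T hT1
    obtain ⟨v, hv, hn1, hnbal, hnb, hT⟩ := hA2 _ hT2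
    obtain ⟨-, -, -, -, -, -, -, -, -, honu, hridu, -, -⟩ := facts u hu
    obtain ⟨-, heq, hIF, hIr, -, -, -, hcold, -⟩ := honu h1
    obtain ⟨-, -, -, hρr, -, -, -⟩ := hridu hne
    obtain ⟨heXv, hēXv, heēv, -, hērv, -, ⟨hDF, hDē⟩, -, hoffv, -, -, -, -⟩ := facts v hv
    obtain ⟨hJr, hDr, hJI'⟩ := hoffv hn1
    have hXFu := (hdata u hu).2.1
    obtain ⟨-, hXFv, -, -, -, -, hJFv, -⟩ := hdata v hv
    have hD : dom v.2 (ēf v) ∈ ({u.2, I₀, ρf u} : Finset ι) := by rw [hT]; simp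
    have hJ : Jf v ∈ ({u.2, I₀, ρf u} : Finset ι) := by rw [hT]; simp
    have hX' : v.2 ∈ ({u.2, I₀, ρf u} : Finset ι) := by rw [hT]; simp
    simp only [mem_insert, mem_singleton] at hD hJ hX'
    have hDI : dom v.2 (ēf v) = I₀ := by
      rcases hD with h | h | h
      · exact absurd (h ▸ hDF) hXFu
      · exact h
      · exfalso; rw [h] at hDr; rcases hDr with h' | h'; exacts [hρr.1 h', hρr.2 h']
    have hJρ : Jf v = ρf u := by
      rcases hJ with h | h | h
      · exact absurd (h ▸ hJFv) hXFu
      · exact absurd h hJI'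
      · exact h
    have hXX : v.2 = u.2 := by
      rcases hX' with h | h | h
      · exact h
      · exact absurd (h ▸ hIF) hXFv
      · rw [← hJρ] at h; exact absurd (h ▸ hJFv) hXFv
    rw [hXX] at hDI heXv hēXv hDē
    rw [hDI] at hDē
    have hēv : ēf v = ef u := by
      rcases hDē with h | h
      · exact h.symm.trans heq
      · exact absurd (h.symm.trans hIr) hērv
    have hev : ef v = ēf u := by
      rcases hports u hu (ef v) heXv with h | h
      · exact absurd (h.trans hēv.symm) heēv
      · exact h
    apply hnbal
    refine ⟨hn1, fun h => hnb ⟨by rw [hXX, hDI]; exact hIr, h.symm⟩, ?_⟩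
    rw [hXX, hev]; exact hcold
  · -- R1 vs SELF′
    obtain ⟨u, hu, h1, hne, rfl⟩ := hA1 T hT1
    obtain ⟨v, hv, hn1, ⟨⟨-, hIF, hIr⟩, hDIv⟩, hT⟩ := hA3 _ hT2
    obtain ⟨heXu, -, -, -, -, -, -, -, -, honu, hridu, -, -⟩ := facts u hu
    obtain ⟨-, heq, -, -, -, -, -, -, -⟩ := honu h1
    obtain ⟨-, -, -, -, -, -, hρR1⟩ := hridu hne
    obtain ⟨hρe, -⟩ := hρR1 h1
    obtain ⟨heXv, hēXv, heēv, -, -, -, -, -, hoffv, -, -, -, hdomIv⟩ := facts v hv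
    obtain ⟨-, hDr, hJI'⟩ := hoffv hn1
    have hXFu := (hdata u hu).2.1
    obtain ⟨-, hXFv, -, -, -, -, hJFv, -, -, -, hJev, -, -, -⟩ := hdata v hv
    have hJ : Jf v ∈ ({u.2, I₀, ρf u} : Finset ι) := by rw [hT]; simp
    have hX' : v.2 ∈ ({u.2, I₀, ρf u} : Finset ι) := by rw [hT]; simp
    simp only [mem_insert, mem_singleton] at hJ hX'
    have hJρ : Jf v = ρf u := by
      rcases hJ with h | h | h
      · exact absurd (h ▸ hJFv) hXFu
      · exact absurd h hJI'
      · exact h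
    have hXX : v.2 = u.2 := by
      rcases hX' with h | h | h
      · exact h
      · exact absurd (h ▸ hIF) hXFv
      · rw [← hJρ] at h; exact absurd (h ▸ hJFv) hXFv
    rw [hXX] at heXv hēXv hdomIv hDr hDIv
    rcases hports u hu (ef v) heXv with h | h
    · apply hρe; rw [← hJρ, ← h]; exact hJev
    · have hēv : ēf v = ef u := by
        rcases hports u hu (ēf v) hēXv with h' | h'
        · exact h'
        · exact absurd (h.trans h'.symm) heēv
      rw [hēv] at hDr hDIv
      exact hDIv (hdomIv (ef u) heXu heq.symm hIF hIr hDr)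
  · -- R1 vs SELF_I
    obtain ⟨u, hu, h1, hne, rfl⟩ := hA1 T hT1
    obtain ⟨w, hw, hT⟩ := mem_image.1 hT2
    obtain ⟨-, hXFw, -, hIF, hIr, hDhF, -, hDhr, -, -⟩ := hI w hw
    obtain ⟨-, -, -, -, -, -, -, -, -, honu, hridu, -, -⟩ := facts u hu
    obtain ⟨-, -, -, -, -, -, hau, -, -⟩ := honu h1
    obtain ⟨-, -, -, -, hρD, -, -⟩ := hridu hne
    have hXFu := (hdata u hu).2.1
    have hD : dom w.2 (if P w.2 = P I₀ then P' w.2 else P w.2) ∈ ({u.2, I₀, ρf u} : Finset ι) := by rw [← hT]; simp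
    have hX' : w.2 ∈ ({u.2, I₀, ρf u} : Finset ι) := by rw [← hT]; simp
    simp only [mem_insert, mem_singleton] at hD hX'
    have hDρ : dom w.2 (if P w.2 = P I₀ then P' w.2 else P w.2) = ρf u := by
      rcases hD with h | h | h
      · exact absurd (h ▸ hDhF) hXFu
      · exfalso; rw [h] at hDhr; exact hDhr.2 hIr
      · exact h
    have hXX : w.2 = u.2 := by
      rcases hX' with h | h | h
      · exact h
      · exact absurd (h ▸ hIF) hXFw
      · rw [← hDρ] at h; exact absurd (h ▸ hDhF) hXFw
    rw [hXX, hau] at hDρ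
    exact hρD hDρ.symm
  · -- R1 vs CROSS_I
    obtain ⟨u, hu, h1, hne, rfl⟩ := hA1 T hT1
    obtain ⟨X₁, X₂, ⟨w₁, hw₁, rfl⟩, ⟨w₂, hw₂, rfl⟩, -, hT⟩ := hA5 _ hT2
    obtain ⟨-, -, hXq₁, -, hIr, -⟩ := hI w₁ hw₁
    obtain ⟨-, -, hXq₂, -⟩ := hI w₂ hw₂
    obtain ⟨-, -, -, -, -, -, -, -, -, honu, hridu, -, -⟩ := facts u hu
    obtain ⟨-, heq, -, -, -, -, -, -, -⟩ := honu h1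
    obtain ⟨-, -, -, hρr, -, -, hρR1⟩ := hridu hne
    obtain ⟨hρe, -⟩ := hρR1 h1
    have hρ' : ρf u ∈ ({w₁.2, w₂.2, I₀} : Finset ι) := by rw [← hT]; simp
    simp only [mem_insert, mem_singleton] at hρ'
    rcases hρ' with h | h | h
    · apply hρe; rw [h, ← heq]; exact hXq₁
    · apply hρe; rw [h, ← heq]; exact hXq₂
    · rw [h] at hρr; exact hρr.2 hIr

end StarSet

end Summit.CriticalPhenomena.PercolationContinuityZ3.Theorems
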